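import Literature.Computability.AlgebraicComplexity.ST21FormulaComplexityBounds
import Literature.Computability.AlgebraicComplexity.ST21ROABPOrbitHittingSets
import Literature.Computability.AlgebraicComplexity.HittingSetsExist
import HarnessLib

/-!
# Saha–Thankey 2021, Thm. 10 (hitting sets for orbits of occur-once formulas) — the discharge

Topic `Literature/Computability/AlgebraicComplexity` (cell `val-lit`, row X3-ST21). Theorem-only file
(no definitions, no named facts) proving the tree's named fact
`sahaThankey2021_thm_10` (`ST21OrbitHittingSets.lean`) AS TYPED — the EXISTENCE reading of
C. Saha, B. Thankey, APPROX/RANDOM 2021 (LIPIcs 207:50), Thm. 10 (p. 50:5 L27–31): for the class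
`C` of `n`-variate degree-`≤ D` polynomials computed by occur-once formulas with `s`-sparse
(resp. `b`-variate) leaves, over a field with `|F| > nD`, a hitting set for `orb(C)` of size
`≤ (nD)^{c(log₂ n + log₂ s + 1)} + c` (resp. `≤ (nD)^{c(log₂ n + b + 1)} + c`) exists; here `c = 320`.

ROUTE (≠ the printed explicit construction, which goes through Medini–Shpilka's Thm. 7 and the
authors' structural analysis; disclosed): the typed statement only asserts EXISTENCE of a small
hitting set, and that follows from **Heintz–Schnorr** — the tree's `HittingSets.exists_hittingSet`
(`HittingSetsExist.lean`: over any field, for any `S ⊆ F` with `|S| ≥ 2d+1` there are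
`≤ 9376(n+d+L+2)²⁶·(log₂(|S|ⁿ(3d+1)+1)+1)+1` points of `Sⁿ` hitting every nonzero polynomial of
degree `≤ d` and circuit complexity `≤ L`) — once the members of `orb(C)` are shown to have small
complexity: `ST21FormulaComplexityBounds.lean` proves `L(φ.eval) ≤ (2s(D+1) + (D+3)(2+log₂ D))·n`
for occur-once `φ` with `s`-sparse leaves and `deg φ.eval ≤ D` (semantic induction: constants folded,
unary chains compressed, siblings variable-disjoint), `(2(D+1)^{b+1} + …)·n` for `b`-variate leaves,
and `L(f(Ax)) ≤ L(f) + n(2n+1)`. The budget `9376(…)²⁶(…)` is absorbed by `(nD)^{320(…)}` when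
`n ≥ 2, D ≥ 1` (`card_bound_of_le_pow`); the corners `n = 0`, `D = 0` (constants: one point) and
`n = 1` (`D+1` collinear points; only `|F| > D` is needed) use the grid
`ROABPCover.exists_hittingSet_of_totalDegree_lt` of `ST21ROABPOrbitHittingSets.lean`. The typed
characteristic hypothesis (`char F = 0 ∨ char F > D`) is NOT used (the existence statement holds
without it).

HONEST FRAMING: a 2021 published theorem's existence/size reading (explicitness dropped by the
typing, WEAKER than print) becomes a theorem of the tree; this validates the V4 method catalogue
entry, it is not progress on `VP ≠ VNP`, which is NOT proved.

## References

* [SahaThankey2021] C. Saha, B. Thankey, APPROX/RANDOM 2021, LIPIcs 207:50, Thm. 10 (p. 50:5).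
* [HeintzSchnorr1980] J. Heintz, C.-P. Schnorr, STOC 1980, Thm. 4.4 (the engine, via the tree).
-/

noncomputable section

open MvPolynomial

namespace Literature.Computability.AlgebraicComplexity

namespace SahaThankey2021

variable {F : Type*} [Field F] {n : ℕ}

/-! ### Arithmetic: absorbing the Heintz–Schnorr budget into `(nD)^{O(·)}` -/

section Arith

/-- `log₂(aⁿ·b + 1) ≤ n·a + b` (crude). [folklore] -/
private theorem log_two_pow_mul_succ_le (a b n : ℕ) : Nat.log 2 (a ^ n * b + 1) ≤ n * a + b := by
  have ha : a ^ n ≤ 2 ^ (n * a) := by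
    calc a ^ n ≤ (2 ^ a) ^ n := Nat.pow_le_pow_left Nat.lt_two_pow_self.le n
      _ = 2 ^ (n * a) := by rw [← pow_mul, mul_comm]
  have hY : a ^ n * b + 1 < 2 ^ (n * a + b + 1) := by
    have hb1 : b + 1 ≤ 2 ^ b := Nat.lt_two_pow_self
    have h1 : 1 ≤ 2 ^ (n * a) := Nat.one_le_two_pow
    calc a ^ n * b + 1 ≤ 2 ^ (n * a) * b + 2 ^ (n * a) * 1 :=
          Nat.add_le_add (Nat.mul_le_mul_right _ ha) (by simpa using h1)
      _ = 2 ^ (n * a) * (b + 1) := by ring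
      _ ≤ 2 ^ (n * a) * 2 ^ b := Nat.mul_le_mul_left _ hb1
      _ = 2 ^ (n * a + b) := by rw [pow_add]
      _ < 2 ^ (n * a + b + 1) := Nat.pow_lt_pow_right (by norm_num) (by omega)
  have := Nat.log_lt_of_lt_pow (by omega) hY
  omega

/-- Powers of `X ≥ 1` are monotone in the exponent. [folklore] -/
private theorem pow_mono {X a b : ℕ} (hX : 2 ≤ X) (h : a ≤ b) : X ^ a ≤ X ^ b :=
  Nat.pow_le_pow_right (by omega) h

/-- `X^a + X^a ≤ X^(a+1)` for `X ≥ 2`. [folklore] -/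
private theorem pow_add_pow_le {X a : ℕ} (hX : 2 ≤ X) : X ^ a + X ^ a ≤ X ^ (a + 1) := by
  calc X ^ a + X ^ a = 2 * X ^ a := by ring
    _ ≤ X * X ^ a := Nat.mul_le_mul_right _ hX
    _ = X ^ (a + 1) := by ring

/-- `m · X^a ≤ X^(a+k)` as soon as `m ≤ 2^k`, for `X ≥ 2`. [folklore] -/
private theorem const_mul_pow_le {X a m k : ℕ} (hX : 2 ≤ X) (hm : m ≤ 2 ^ k) :
    m * X ^ a ≤ X ^ (a + k) := by
  calc m * X ^ a ≤ X ^ k * X ^ a := Nat.mul_le_mul_right _ (hm.trans (Nat.pow_le_pow_left hX k))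
    _ = X ^ (a + k) := by ring

/-- **The Heintz–Schnorr count is absorbed**: with `X = nD`, `2 ≤ X` and `n + D + M + 2 ≤ X^K`, one
has `9376·(n+D+M+2)²⁶·(log₂((2D+1)ⁿ(3D+1)+1)+1) + 1 ≤ X^(26K+19)`. [folklore] -/
private theorem hs_count_le_pow {X n D M K : ℕ} (hX : 2 ≤ X) (hnD : n * D = X) (hn : n ≤ X)
    (hD : D ≤ X) (hB : n + D + M + 2 ≤ X ^ K) :
    9376 * (n + D + M + 2) ^ 26 * (Nat.log 2 ((2 * D + 1) ^ n * (3 * D + 1) + 1) + 1) + 1 ≤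
      X ^ (26 * K + 19) := by
  have h1 : 9376 ≤ X ^ 14 := by
    have h : (9376 : ℕ) ≤ 2 ^ 14 := by norm_num
    exact h.trans (Nat.pow_le_pow_left hX 14)
  have h2 : (n + D + M + 2) ^ 26 ≤ X ^ (26 * K) := by
    calc (n + D + M + 2) ^ 26 ≤ (X ^ K) ^ 26 := Nat.pow_le_pow_left hB 26
      _ = X ^ (26 * K) := by rw [← pow_mul, mul_comm]
  have h3 : Nat.log 2 ((2 * D + 1) ^ n * (3 * D + 1) + 1) + 1 ≤ X ^ 4 := by
    have hl := log_two_pow_mul_succ_le (2 * D + 1) (3 * D + 1) n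
    have he : n * (2 * D + 1) = 2 * (n * D) + n := by ring
    rw [he, hnD] at hl
    have h7 : Nat.log 2 ((2 * D + 1) ^ n * (3 * D + 1) + 1) + 1 ≤ 7 * X := by omega
    have h73 : 7 ≤ X ^ 3 := le_trans (by norm_num : (7 : ℕ) ≤ 2 ^ 3) (Nat.pow_le_pow_left hX 3)
    calc _ ≤ 7 * X := h7
      _ ≤ X ^ 3 * X := Nat.mul_le_mul_right _ h73
      _ = X ^ 4 := by ring
  have h4 : X ^ 14 * X ^ (26 * K) * X ^ 4 = X ^ (26 * K + 18) := by ring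
  calc 9376 * (n + D + M + 2) ^ 26 * (Nat.log 2 ((2 * D + 1) ^ n * (3 * D + 1) + 1) + 1) + 1
      ≤ X ^ 14 * X ^ (26 * K) * X ^ 4 + 1 :=
        Nat.add_le_add_right (Nat.mul_le_mul (Nat.mul_le_mul h1 h2) h3) 1
    _ = X ^ (26 * K + 18) + 1 := by rw [h4]
    _ ≤ X ^ (26 * K + 18) + X ^ (26 * K + 18) :=
        Nat.add_le_add_left (Nat.one_le_pow _ _ (by omega)) _
    _ ≤ X ^ (26 * K + 18 + 1) := pow_add_pow_le hX
    _ = X ^ (26 * K + 19) := by ring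

/-- The common tail of both leaf regimes: `(D+3)(2 + log₂ D) ≤ 12 X²` (`1 ≤ D ≤ X`). [folklore] -/
private theorem deg_term_le {X D : ℕ} (hD1 : 1 ≤ D) (hD : D ≤ X) :
    (D + 3) * (2 + Nat.log 2 D) ≤ 12 * X ^ 2 := by
  have h1 : D + 3 ≤ 4 * D := by omega
  have h2 : 2 + Nat.log 2 D ≤ 3 * D := by
    have := Nat.log_le_self 2 D
    omega
  calc (D + 3) * (2 + Nat.log 2 D) ≤ (4 * D) * (3 * D) := Nat.mul_le_mul h1 h2
    _ = 12 * D ^ 2 := by ring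
    _ ≤ 12 * X ^ 2 := Nat.mul_le_mul_left _ (Nat.pow_le_pow_left hD 2)

/-- `n ≤ nD` and `D ≤ nD` when `n, D ≥ 1`. [folklore] -/
private theorem le_of_mul_eq {X n D : ℕ} (hnD : n * D = X) (hn1 : 1 ≤ n) (hD1 : 1 ≤ D) :
    n ≤ X ∧ D ≤ X := by
  constructor
  · calc n = n * 1 := (mul_one n).symm
      _ ≤ n * D := Nat.mul_le_mul_left _ hD1
      _ = X := hnD
  · calc D = 1 * D := (one_mul D).symm
      _ ≤ n * D := Nat.mul_le_mul_right _ hn1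
      _ = X := hnD

/-- Budget of the `s`-sparse clause: with `t = log₂ s`,
`n + D + ((2s(D+1) + (D+3)(2+log₂ D))·n + n(2n+1)) + 2 ≤ X^(t+8)`. [folklore] -/
private theorem base_le_pow_sparse {X n D s : ℕ} (hX : 2 ≤ X) (hnD : n * D = X) (hn1 : 1 ≤ n)
    (hD1 : 1 ≤ D) :
    n + D + ((2 * s * (D + 1) + (D + 3) * (2 + Nat.log 2 D)) * n + n * (2 * n + 1)) + 2 ≤
      X ^ (Nat.log 2 s + 8) := by
  obtain ⟨hn, hD⟩ := le_of_mul_eq hnD hn1 hD1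
  have hs : s ≤ X ^ (Nat.log 2 s + 1) :=
    (Nat.lt_pow_succ_log_self one_lt_two s).le.trans (Nat.pow_le_pow_left hX _)
  have hX2 : X ^ 2 ≤ X ^ (Nat.log 2 s + 2) := pow_mono hX (by omega)
  have hX1 : X ≤ X ^ (Nat.log 2 s + 3) := by
    calc X = X ^ 1 := (pow_one X).symm
      _ ≤ X ^ (Nat.log 2 s + 3) := pow_mono hX (by omega)
  have hw1 : 2 * s * (D + 1) ≤ 4 * X ^ (Nat.log 2 s + 2) := by
    have hD2 : D + 1 ≤ 2 * X := by omega
    calc 2 * s * (D + 1) ≤ 2 * X ^ (Nat.log 2 s + 1) * (2 * X) :=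
          Nat.mul_le_mul (Nat.mul_le_mul_left 2 hs) hD2
      _ = 4 * X ^ (Nat.log 2 s + 2) := by ring
  have hw2 := deg_term_le hD1 hD
  have hw : 2 * s * (D + 1) + (D + 3) * (2 + Nat.log 2 D) ≤ 16 * X ^ (Nat.log 2 s + 2) := by omega
  have hL : (2 * s * (D + 1) + (D + 3) * (2 + Nat.log 2 D)) * n ≤ 16 * X ^ (Nat.log 2 s + 3) := by
    calc _ ≤ 16 * X ^ (Nat.log 2 s + 2) * X := Nat.mul_le_mul hw hn
      _ = 16 * X ^ (Nat.log 2 s + 3) := by ring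
  have hq : n * (2 * n + 1) ≤ 3 * X ^ (Nat.log 2 s + 3) := by
    calc n * (2 * n + 1) ≤ X * (2 * X + 1) := Nat.mul_le_mul hn (by omega)
      _ ≤ X * (3 * X) := Nat.mul_le_mul_left _ (by omega)
      _ = 3 * X ^ 2 := by ring
      _ ≤ 3 * X ^ (Nat.log 2 s + 3) := Nat.mul_le_mul_left _ (pow_mono hX (by omega))
  have h22 : n + D + ((2 * s * (D + 1) + (D + 3) * (2 + Nat.log 2 D)) * n + n * (2 * n + 1)) + 2 ≤
      22 * X ^ (Nat.log 2 s + 3) := by omega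
  have h5 : X ^ (Nat.log 2 s + 3 + 5) = X ^ (Nat.log 2 s + 8) := by ring
  exact h22.trans ((const_mul_pow_le (k := 5) hX (by norm_num)).trans h5.le)

/-- Budget of the `b`-variate clause:
`n + D + ((2(D+1)^{b+1} + (D+3)(2+log₂ D))·n + n(2n+1)) + 2 ≤ X^(2b+11)`. [folklore] -/
private theorem base_le_pow_variate {X n D b : ℕ} (hX : 2 ≤ X) (hnD : n * D = X) (hn1 : 1 ≤ n)
    (hD1 : 1 ≤ D) :
    n + D + ((2 * (D + 1) ^ (b + 1) + (D + 3) * (2 + Nat.log 2 D)) * n + n * (2 * n + 1)) + 2 ≤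
      X ^ (2 * b + 11) := by
  obtain ⟨hn, hD⟩ := le_of_mul_eq hnD hn1 hD1
  have hD2 : D + 1 ≤ X ^ 2 := by nlinarith
  have hw1 : 2 * (D + 1) ^ (b + 1) ≤ X ^ (2 * b + 3) := by
    have hp : (D + 1) ^ (b + 1) ≤ X ^ (2 * b + 2) := by
      calc (D + 1) ^ (b + 1) ≤ (X ^ 2) ^ (b + 1) := Nat.pow_le_pow_left hD2 _
        _ = X ^ (2 * b + 2) := by rw [← pow_mul]; ring_nf
    have h1 : X ^ (2 * b + 2 + 1) = X ^ (2 * b + 3) := by ring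
    exact (Nat.mul_le_mul_left 2 hp).trans ((const_mul_pow_le (k := 1) hX (by norm_num)).trans h1.le)
  have hw2 : (D + 3) * (2 + Nat.log 2 D) ≤ X ^ (2 * b + 6) := by
    refine (deg_term_le hD1 hD).trans ?_
    exact (const_mul_pow_le (k := 4) hX (by norm_num)).trans (pow_mono hX (by omega))
  have hw : 2 * (D + 1) ^ (b + 1) + (D + 3) * (2 + Nat.log 2 D) ≤ X ^ (2 * b + 7) := by
    calc _ ≤ X ^ (2 * b + 6) + X ^ (2 * b + 6) :=
          Nat.add_le_add (hw1.trans (pow_mono hX (by omega))) hw2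
      _ ≤ X ^ (2 * b + 6 + 1) := pow_add_pow_le hX
      _ = X ^ (2 * b + 7) := by ring
  have hL : (2 * (D + 1) ^ (b + 1) + (D + 3) * (2 + Nat.log 2 D)) * n ≤ X ^ (2 * b + 8) := by
    calc _ ≤ X ^ (2 * b + 7) * X := Nat.mul_le_mul hw hn
      _ = X ^ (2 * b + 8) := by ring
  have hq : n * (2 * n + 1) ≤ X ^ (2 * b + 8) := by
    calc n * (2 * n + 1) ≤ X * (2 * X + 1) := Nat.mul_le_mul hn (by omega)
      _ ≤ X * (3 * X) := Nat.mul_le_mul_left _ (by omega)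
      _ = 3 * X ^ 2 := by ring
      _ ≤ X ^ (2 + 2) := const_mul_pow_le (k := 2) hX (by norm_num)
      _ ≤ X ^ (2 * b + 8) := pow_mono hX (by omega)
  have hr : n + D + 2 ≤ X ^ (2 * b + 8) := by
    calc n + D + 2 ≤ 3 * X ^ 1 := by rw [pow_one]; omega
      _ ≤ X ^ (1 + 2) := const_mul_pow_le (k := 2) hX (by norm_num)
      _ ≤ X ^ (2 * b + 8) := pow_mono hX (by omega)
  have h3 : n + D + ((2 * (D + 1) ^ (b + 1) + (D + 3) * (2 + Nat.log 2 D)) * n + n * (2 * n + 1)) + 2 ≤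
      3 * X ^ (2 * b + 8) := by omega
  calc _ ≤ 3 * X ^ (2 * b + 8) := h3
    _ ≤ X ^ (2 * b + 8 + 2) := const_mul_pow_le (k := 2) hX (by norm_num)
    _ ≤ X ^ (2 * b + 11) := pow_mono hX (by omega)

end Arith

/-! ### The main case `n ≥ 2`: Heintz–Schnorr on the orbit class -/

section Main

/-- **Orbits of a class of cheap low-degree polynomials have small hitting sets (existence).**
If every member of `𝒞` has degree `≤ D` and complexity `≤ L`, `|F| > nD`, `n ≥ 2`, and
`n + D + (L + n(2n+1)) + 2 ≤ (nD)^K`, then `orb(𝒞)` has a hitting set of size `≤ (nD)^(26K+19)`: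
orbit members have degree `≤ D` and complexity `≤ L + n(2n+1)`, and `HittingSets.exists_hittingSet`
(Heintz–Schnorr, any field) applies with `|S| = 2D+1 ≤ |F|`.
[cite: HeintzSchnorr1980, Thm. 4.4 (via the tree's `HittingSets.exists_hittingSet`)] -/
theorem exists_hittingSet_orb_of_complexity_le {D L K : ℕ} (𝒞 : Set (MvPolynomial (Fin n) F))
    (hdeg : ∀ f ∈ 𝒞, f.totalDegree ≤ D) (hL : ∀ f ∈ 𝒞, complexity f ≤ L)
    (hF : Infinite F ∨ n * D < Nat.card F) (hn : 2 ≤ n)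
    (hK : n + D + (L + n * (2 * n + 1)) + 2 ≤ (n * D) ^ K) :
    ∃ H : Finset (Fin n → F), H.card ≤ (n * D) ^ (26 * K + 19) ∧
      HittingSets.IsHittingSetFor (↑H) (orb F 𝒞) := by
  classical
  -- a set of `2D+1` field elements
  obtain ⟨S, hS⟩ : ∃ S : Finset F, S.card = 2 * D + 1 := by
    refine MS2021.exists_finset_card_eq (2 * D + 1) (hF.imp id fun h => ?_)
    have : 2 * D ≤ n * D := Nat.mul_le_mul_right _ hn
    omega
  obtain ⟨H, -, hcard, hhit⟩ :=
    HittingSets.exists_hittingSet n (L + n * (2 * n + 1)) D S (by rw [hS])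
  rw [hS] at hcard
  -- `X = nD ≥ 2`, `D ≥ 1` (else `hK` is absurd), so the count is absorbed
  have hD1 : 1 ≤ D := by
    rcases Nat.eq_zero_or_pos D with rfl | h
    · rw [mul_zero] at hK
      rcases Nat.eq_zero_or_pos K with rfl | hK0
      · rw [pow_zero] at hK; omega
      · rw [zero_pow (by omega)] at hK; omega
    · exact h
  obtain ⟨hnX, hDX⟩ := le_of_mul_eq (X := n * D) rfl (by omega) hD1
  have hX : 2 ≤ n * D := hn.trans hnX
  refine ⟨H, hcard.trans ?_, fun g hg hg0 => ?_⟩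
  · exact hs_count_le_pow (M := L + n * (2 * n + 1)) (K := K) hX rfl hnX hDX hK
  · rw [mem_orb_iff] at hg
    obtain ⟨f, hf, hgf⟩ := hg
    exact hhit g ((totalDegree_le_of_mem_linOrbit hgf).trans (hdeg f hf))
      ((complexity_le_of_mem_linOrbit hgf).trans (Nat.add_le_add_right (hL f hf) _)) hg0

/-- The corners `n ≤ 1` or `D = 0`, then the main case: every orbit class of degree-`≤ D` polynomials
with a hitting set of size `≤ (nD)^E` in the main case (`n ≥ 2`, `D ≥ 1`) has one of size
`≤ (nD)^E + 320` outright (`|F| > nD` supplies the `D + 1` collinear points of the case `n = 1`;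
constants need one point). [cite: SahaThankey2021, Thm. 10 (p. 50:5) (size reading)] -/
theorem exists_hittingSet_orb_with_corners {D E : ℕ} (𝒞 : Set (MvPolynomial (Fin n) F))
    (hdeg : ∀ f ∈ 𝒞, f.totalDegree ≤ D) (hF : Infinite F ∨ n * D < Nat.card F) (hE : 1 ≤ E)
    (hmain : 2 ≤ n → 1 ≤ D → ∃ H : Finset (Fin n → F), H.card ≤ (n * D) ^ E ∧
      HittingSets.IsHittingSetFor (↑H) (orb F 𝒞)) :
    ∃ H : Finset (Fin n → F), H.card ≤ (n * D) ^ E + 320 ∧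
      HittingSets.IsHittingSetFor (↑H) (orb F 𝒞) := by
  classical
  have hdeg' : ∀ g ∈ orb F 𝒞, g.totalDegree ≤ D := fun g hg => by
    rw [mem_orb_iff] at hg
    obtain ⟨f, hf, hgf⟩ := hg
    exact (totalDegree_le_of_mem_linOrbit hgf).trans (hdeg f hf)
  rcases Nat.lt_or_ge n 2 with hn | hn
  · -- `n ≤ 1`
    interval_cases n
    · -- `n = 0`: all polynomials are constants; one point
      have hdeg0 : ∀ g ∈ orb F 𝒞, g.totalDegree ≤ 0 := fun g _ =>
        Finset.sup_le fun m _ => by rw [Subsingleton.elim m 0, Finsupp.sum_zero_index]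
      obtain ⟨H, hH, hhit⟩ := ROABPCover.exists_hittingSet_of_totalDegree_lt (orb F 𝒞) hdeg0
        ({0} : Finset F) (by simp)
      exact ⟨H, hH.trans (by simp only [Finset.card_singleton, pow_zero]; omega), hhit⟩
    · -- `n = 1`: `D + 1` points on the line
      obtain ⟨W, hW⟩ : ∃ W : Finset F, W.card = D + 1 :=
        MS2021.exists_finset_card_eq (D + 1) (hF.imp id fun h => by omega)
      obtain ⟨H, hH, hhit⟩ := ROABPCover.exists_hittingSet_of_totalDegree_lt (orb F 𝒞) hdeg' W
        (by omega)
      refine ⟨H, hH.trans ?_, hhit⟩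
      rw [hW, pow_one, one_mul]
      rcases Nat.eq_zero_or_pos D with rfl | hD
      · simp
      · have : D ≤ D ^ E := Nat.le_self_pow (by omega) D
        omega
  · rcases Nat.eq_zero_or_pos D with rfl | hD
    · -- `D = 0`: constants; one point
      obtain ⟨H, hH, hhit⟩ := ROABPCover.exists_hittingSet_of_totalDegree_lt (orb F 𝒞) hdeg'
        ({0} : Finset F) (by simp)
      exact ⟨H, hH.trans (by simp only [Finset.card_singleton, one_pow]; omega), hhit⟩
    · obtain ⟨H, hH, hhit⟩ := hmain hn hD
      exact ⟨H, hH.trans (Nat.le_add_right _ _), hhit⟩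

end Main

/-! ### The discharge -/

section Discharge

/-- Members of Thm. 10's class (occur-once, `s`-sparse leaves, degree `≤ D`) are cheap.
[cite: SahaThankey2021, Thm. 10 (p. 50:5)] -/
theorem complexity_le_of_mem_occurOnceSparse {D s : ℕ} {f : MvPolynomial (Fin n) F}
    (hf : f ∈ {f : MvPolynomial (Fin n) F | f.totalDegree ≤ D ∧
      ∃ φ : Formula F n, φ.IsOccur 1 ∧ φ.LeavesSparse s ∧ φ.eval = f}) :
    complexity f ≤ (2 * s * (D + 1) + (D + 3) * (2 + Nat.log 2 D)) * n := by
  obtain ⟨hD, φ, hocc, hs, rfl⟩ := hf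
  exact complexity_eval_le_of_isOccur_one_of_leavesSparse φ hocc hs hD

/-- Members of Thm. 10's second class (occur-once, `b`-variate leaves, degree `≤ D`) are cheap.
[cite: SahaThankey2021, Thm. 10 (p. 50:5)] -/
theorem complexity_le_of_mem_occurOnceVariate {D s b : ℕ} {f : MvPolynomial (Fin n) F}
    (hf : f ∈ {f : MvPolynomial (Fin n) F | f.totalDegree ≤ D ∧
      ∃ φ : Formula F n, φ.IsOccur 1 ∧ φ.LeavesSparse s ∧ φ.LeavesVariate b ∧ φ.eval = f}) :
    complexity f ≤ (2 * (D + 1) ^ (b + 1) + (D + 3) * (2 + Nat.log 2 D)) * n := by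
  obtain ⟨hD, φ, hocc, -, hb, rfl⟩ := hf
  exact complexity_eval_le_of_isOccur_one_of_leavesVariate φ hocc hb hD

end Discharge

end SahaThankey2021

open SahaThankey2021 HittingSets in
/-- **Saha–Thankey 2021, Thm. 10 — DISCHARGED (existence/size reading, as typed; `c = 320`).**
For every field `F` and all `n, D, s` with `|F| > nD` (or `F` infinite): the orbit of the class of
`n`-variate degree-`≤ D` polynomials computed by occur-once formulas with `s`-sparse leaves has a
hitting set of size `≤ (nD)^{320(log₂ n + log₂ s + 1)} + 320`, and with `b`-variate leaves one of size
`≤ (nD)^{320(log₂ n + b + 1)} + 320`. Route: Heintz–Schnorr existence (`HittingSets.exists_hittingSet`)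
on the complexity bounds of `ST21FormulaComplexityBounds.lean`; the printed route (explicit, via
[MS21] Thm. 7) is not followed and the characteristic hypothesis is not used.
[cite: SahaThankey2021, Thm. 10 (p. 50:5 L27-31)] -/
theorem sahaThankey2021_thm_10_holds : sahaThankey2021_thm_10 := by
  refine ⟨320, fun F _ n D s hF _ => ⟨?_, fun b => ?_⟩⟩
  · refine exists_hittingSet_orb_with_corners _ (fun f hf => hf.1) hF
      (by omega) fun hn hD => ?_
    have hX : 2 ≤ n * D := hn.trans (le_of_mul_eq (X := n * D) rfl (by omega) hD).1
    obtain ⟨H, hH, hhit⟩ := exists_hittingSet_orb_of_complexity_le _ (fun f hf => hf.1)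
      (fun f hf => complexity_le_of_mem_occurOnceSparse hf) hF hn
      (base_le_pow_sparse hX rfl (by omega) hD)
    exact ⟨H, hH.trans (Nat.pow_le_pow_right (by omega) (by omega)), hhit⟩
  · refine exists_hittingSet_orb_with_corners _ (fun f hf => hf.1) hF
      (by omega) fun hn hD => ?_
    have hX : 2 ≤ n * D := hn.trans (le_of_mul_eq (X := n * D) rfl (by omega) hD).1
    obtain ⟨H, hH, hhit⟩ := exists_hittingSet_orb_of_complexity_le _ (fun f hf => hf.1)
      (fun f hf => complexity_le_of_mem_occurOnceVariate hf) hF hn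
      (base_le_pow_variate hX rfl (by omega) hD)
    exact ⟨H, hH.trans (Nat.pow_le_pow_right (by omega) (by omega)), hhit⟩

end Literature.Computability.AlgebraicComplexity

end
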